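import Summits.AtomisticToContinuum.BoseEinsteinCondensation.Theorems.BECThomsonPrincipleGaussianDominationCanCoreReduction
import Summits.AtomisticToContinuum.BoseEinsteinCondensation.Theorems.BECThomsonPrincipleGaussianDominationCanBoundedCase
import Summits.AtomisticToContinuum.BoseEinsteinCondensation.Theorems.GaussianDominationCan.Negative.LoadBearing
import Summits.AtomisticToContinuum.BoseEinsteinCondensation.Theorems.GaussianDominationCan.Negative.FreeConstant
import HarnessLib
import HarnessLib.Audit

/-!
# Line `coupling-monotone-chord` — crux `GaussianDominationCan` (stmt-AtomisticToContinuum-9479) — LEAD SKELETON r24 (= r23 = … = r9, re-seat c16)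

Lead prover-line-stmt-AtomisticToContinuum-9479-c16-0 (re-seat c16, HONEST-BET re-audit, 2026-08-17; continuation of c1–c15).  r24 = r23
verbatim in content (registered under this seat): every stub but the sign is LANDED — S1 `stub_lnssSourceBound`, S2 `stub_chordAutomatic`, S3 `stub_anchorBand`
(`Theorems/BECThomsonPrincipleGaussianDominationCanChordCuts.lean`, p138034); S4 `stub_chordTransportFrom`
(`…GaussianDominationCanChordTransportFrom.lean`, p138300); the composition `stub_gdCan_of_sourceRaisesInteractionCore`
(`…GaussianDominationCanCoreReduction.lean`, p138503); D2 `stub_truncationLimit` (`…GaussianDominationCanHardCoreReduction.lean`, p137266).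
**The skeleton has EXACTLY ONE sorry: the trimmed sign `stub_sourceRaisesInteractionCore`** — the LNSS source does not lower the ground-state
interaction energy at the CORE source strengths `{s ≥ 0 : s·L² < 4π²√N‖n‖∞², s²L² ≤ 4π²‖n‖∞² E₀(w)}` of every bounded range-`R₀` potential `w`
in the dilute window `N ≤ ρ₀(M,R₀)L³`, `k∞ ≤ M√ρ` — and the composition gives the crux BY NAME for EVERY repulsive finite-range `v` (hard cores
included), `C = 1/(2π²)`, `N₀ = 0`.

Why the remaining stub is the bet (and crux-sized at `s → 0`): `Lines/coupling-monotone-chord-dead.md` (a1), `DREFUTE-coupling-monotone-chord.md`,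
`STRATEGY-CENSUS.md` (gen1 §1/§D1, gen2 §R), `Lines/coupling-monotone-chord-c{3,4,5,6,7,9,10,11,12,13,14}-analysis.md`,
the crux `NOTES.md` (c1–c15): the stub is exactly INCREASING DIFFERENCES of the sourced ground-state energy `e(τ,s)` in (coupling, source)
(kernel-checked both ways: S6 p148597, S7 p149091), i.e. the `(N,L)`-uniform `T = 0` phase-stiffness germ of the continuum dilute Bose gas down
to `k = 2π/L` — true at every controlled order (Hartree sign `ŵ_per(k) > 0` on the window, one loop `∂_τχ_Λ = −2μ′/(k²+2μ)² < 0`, GP edge of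
the window `N/L = 4π²‖n‖²/M²` = Gross–Pitaevskii scaling with `𝔞 = 4π²a‖n‖²/M²`), open in the interior of the window (`aN/L → ∞`, the
thermodynamic limit at fixed `ρ ≤ ρ₀`), where no rigorous Bogoliubov theory exists.  The trim removes the large-`s` tail
(`s ≥ 4π²√N‖n‖²/L²`, automatic) and the above-anchor band (`s²L² > 4π²‖n‖²E₀`), nothing of the germ.  c14 adds: the crux has NO upstream
among the sub-problem's ≈120 cruxes (it is itself upstream of the IR-bound family PeriodicIRBound / BecIrWindow / InfraredMinimumUncertainty
via KLS), so no `blocked-on: X` with a landable `X → crux` exists besides the route's own glue 14723.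

Side cuts landed outside the composition: S5 `kineticSplit_chord` (c6, p143155), S6 `raySign_iff_gain_monotoneOn` (c9, p148597),
S7 `sourceRaisesInteraction_iff_gainMonotone` (c9, p149091).

History: r5 (a1) sorries B + D2a; r6/r7 (c1) D2 discharged; r8 trim + side stubs S1–S4 registered and landed by one wave; r9 (c1) … r22 (c14) /
r23 (c15) / r24 (this file, c16) identical in content.
-/

noncomputable section

namespace Summit.AtomisticToContinuum.BoseEinsteinCondensation.Cruxes.GaussianDominationCan.CouplingMonotoneChord

open MeasureTheory Filter
open scoped ENNReal NNReal BigOperators Topology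
open Literature.MathematicalPhysics.QuantumManyBody.BoseGas
open Summit.AtomisticToContinuum.BoseEinsteinCondensation.Theses
open Summit.AtomisticToContinuum.BoseEinsteinCondensation.Theorems.GaussianDominationCan.Negative
  (GDIneq InWindow GDCanWith gaussianDominationCan_iff sourceIntegral cellAvg theta phase nsq free_const_ge)

/-! ## Audit name of the registered open stub -/

namespace Goal

/-- Statement of the OPEN stub `stub_sourceRaisesInteractionCore` — the sign B restricted to the core range (see the module docstring). -/
abbrev stub_sourceRaisesInteractionCore : Prop :=
  ∀ M : ℝ, 0 < M → ∀ R₀ : ℝ, ∃ ρ₀ : ℝ, 0 < ρ₀ ∧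
    ∀ w : ℝ → ℝ≥0∞, Measurable w → (∀ r, R₀ < r → w r = 0) → (∃ B : ℝ, ∀ r, w r ≤ ENNReal.ofReal B) →
      ∀ m : ℕ, ∀ L : ℝ, 0 < L → ((m + 1 : ℕ) : ℝ) ≤ ρ₀ * L ^ 3 →
        ∀ n : Fin 3 → ℤ, n ≠ 0 → InWindow M m L n → ∀ s : ℝ, 0 ≤ s →
          s * L ^ 2 < 4 * Real.pi ^ 2 * Real.sqrt ((m + 1 : ℕ) : ℝ) * ‖(fun j => (n j : ℝ))‖ ^ 2 →
          s ^ 2 * L ^ 2 ≤ 4 * Real.pi ^ 2 * ‖(fun j => (n j : ℝ))‖ ^ 2 *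
              (periodicGroundStateEnergy w (m + 1) L).toReal →
          groundInteraction w m L n 0 ≤ groundInteraction w m L n s

end Goal

/-! ## The registered open stub (the only sorry) -/

/-- OPEN stub `stub_sourceRaisesInteractionCore` (lead; the bet): the LNSS source never lowers the ground-state interaction energy at the
CORE source strengths, dilute window, `ρ₀(M, R₀)` uniform over bounded `w` of range `R₀`.  Implied by B (`SourceRaisesInteraction`,
`sourceRaisesInteractionCore_of_sourceRaisesInteraction`). -/
theorem stub_sourceRaisesInteractionCore :
    ∀ M : ℝ, 0 < M → ∀ R₀ : ℝ, ∃ ρ₀ : ℝ, 0 < ρ₀ ∧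
      ∀ w : ℝ → ℝ≥0∞, Measurable w → (∀ r, R₀ < r → w r = 0) → (∃ B : ℝ, ∀ r, w r ≤ ENNReal.ofReal B) →
        ∀ m : ℕ, ∀ L : ℝ, 0 < L → ((m + 1 : ℕ) : ℝ) ≤ ρ₀ * L ^ 3 →
          ∀ n : Fin 3 → ℤ, n ≠ 0 → InWindow M m L n → ∀ s : ℝ, 0 ≤ s →
            s * L ^ 2 < 4 * Real.pi ^ 2 * Real.sqrt ((m + 1 : ℕ) : ℝ) * ‖(fun j => (n j : ℝ))‖ ^ 2 →
            s ^ 2 * L ^ 2 ≤ 4 * Real.pi ^ 2 * ‖(fun j => (n j : ℝ))‖ ^ 2 *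
                (periodicGroundStateEnergy w (m + 1) L).toReal →
            groundInteraction w m L n 0 ≤ groundInteraction w m L n s := by
  sorry

/-! ## The kernel-checked composition -/

/-- **The composition**: the open core sign and the LANDED composition `stub_gdCan_of_sourceRaisesInteractionCore` (p138503; S1–S4, D2,
free anchor, IVT along the ray) give the crux BY NAME, every repulsive finite-range `v`, `C = 1/(2π²)`, `N₀ = 0`. -/
theorem GaussianDominationCan_of (b : Goal.stub_sourceRaisesInteractionCore) :
    _root_.Summit.AtomisticToContinuum.BoseEinsteinCondensation.Theses.BECThomsonPrinciple.GaussianDominationCan :=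
  stub_gdCan_of_sourceRaisesInteractionCore b

/-- The skeleton as a (sorried-through-the-stub) proof of the crux. -/
theorem GaussianDominationCan_proof :
    _root_.Summit.AtomisticToContinuum.BoseEinsteinCondensation.Theses.BECThomsonPrinciple.GaussianDominationCan :=
  GaussianDominationCan_of stub_sourceRaisesInteractionCore

/-! ## What is already CERTIFIED (landed theorems only, no sorry enters) -/

/-- The full sign B implies the core sign (`sourceRaisesInteractionCore_of_sourceRaisesInteraction`, p138503). -/
example (hB : SourceRaisesInteraction) : Goal.stub_sourceRaisesInteractionCore :=
  sourceRaisesInteractionCore_of_sourceRaisesInteraction hB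

/-- Fallback composition (p137266): the FULL sign B gives the crux with the SHARP constant `1/(4π²)`. -/
example (hB : SourceRaisesInteraction) : BECThomsonPrinciple.GaussianDominationCan :=
  gaussianDominationCan_of_sourceRaisesInteraction hB

/-- Side stubs S1–S4 and D2 are theorems. -/
example : TruncationLimit := stub_truncationLimit

-- Side cut S5 (c6, p143155): `kineticSplit_chord` in `Theorems/BECThomsonPrincipleGaussianDominationCanKineticSplit.lean`
-- (not imported here only because the skeleton does not use it; the composition needs S1–S4, D2 and the core sign).

/-- The anchor's constant is the least admissible one (`Negative.free_const_ge`). -/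
example {ρ₀ M C : ℝ} {N₀ : ℕ} (hρ : 0 < ρ₀) (hM : 0 < M) (h : GDCanWith ρ₀ C N₀ 0 M) :
    1 / (4 * Real.pi ^ 2) ≤ C :=
  free_const_ge hρ hM h

/-- The FREE instance `v = 0` of the crux (`gdCanWith_free`, p85484). -/
example (ρ₀ M : ℝ) (N₀ : ℕ) : GDCanWith ρ₀ (1 / (4 * Real.pi ^ 2)) N₀ 0 M :=
  gdCanWith_free ρ₀ N₀ M

end Summit.AtomisticToContinuum.BoseEinsteinCondensation.Cruxes.GaussianDominationCan.CouplingMonotoneChord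

end
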